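import Summits.AtomisticToContinuum.Crystallization.Theorems.ExcessDecayLiouvilleDirichletSolve
import Summits.AtomisticToContinuum.Crystallization.Theorems.ExcessDecayLiouvillePoincare

/-!
# Route `ExcessDecayLiouville`: the comparison (energy) inequality in flux form (nonlinear half, III)

Harmonic-replacement architecture for item `ExcessDecay` (stmt-AtomisticToContinuum-9334), nonlinear half.
The Dirichlet correction `w` (finitely supported on the sites `FW` of the correction region) has operator rows
`(L w)(p) = f(p) + Σ_{q ∈ SR, q ≠ p} Φ(p, q)` on `FW ⊆ SR`, with a pointwise forcing `f` and an ANTISYMMETRIC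
flux kernel `Φ` (the modified linearisation remainder of `ExcessDecayLiouvilleEquationFlux`).  Pairing with `w`
and symmetrising the flux:

* `sum_sum_erase_comm` : swapping the order of summation over ordered pairs of distinct elements;
* `flux_symmetrize` : `Σ_p Σ_{q≠p} ⟪Φ p q, W p⟫ = ½ Σ_p Σ_{q≠p} ⟪Φ p q, W p − W q⟫` for antisymmetric `Φ`;
* `comparison_energy` : `κ · nnForm w ≤ Σ_{p∈FW} ⟪f p, w p⟫ + ½ Σ_{p∈SR} Σ_{q∈SR, q≠p} ⟪Φ p q, w p − w q⟫`;
* `comparison_energy_abs`, `sqrt_energy_le` : the Cauchy–Schwarz / Poincaré consequences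
  `κ · nnForm w ≤ ‖f‖_{ℓ²(FW)} ‖w‖_{ℓ²} + ½ ΣΣ ‖Φ‖ ‖Dw‖` and the scalar solving step.

All `[folklore]`; helper lemmas, nothing here closes an item.
-/

noncomputable section

namespace Summit.AtomisticToContinuum.Crystallization.Theorems.ExcessDecayLiouville

open scoped BigOperators Topology InnerProductSpace RealInnerProductSpace Classical
open Literature.MathematicalPhysics.StatisticalMechanics
open Summit.AtomisticToContinuum.Crystallization.Theorems.PhononStabilityNegative

-- Local notation: the force-constant map `K(e)w = h(|e|²)w + 2⟪e,w⟫h′(|e|²)e`.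
local notation3 "𝕂[" e "] " w:max =>
  (-((‖e‖ ^ 2)⁻¹) ^ 7 + ((‖e‖ ^ 2)⁻¹) ^ 4) • w + (2 * ⟪e, w⟫ * (7 * ((‖e‖ ^ 2)⁻¹) ^ 8 - 4 * ((‖e‖ ^ 2)⁻¹) ^ 5)) • e

/-! ## Symmetrising an antisymmetric flux -/

/-- Swapping the order of summation over ordered pairs of distinct elements of a finite set. [folklore] -/
theorem sum_sum_erase_comm {γ M : Type*} [DecidableEq γ] [AddCommMonoid M] (T : Finset γ) (F : γ → γ → M) :
    ∑ p ∈ T, ∑ q ∈ T.erase p, F p q = ∑ q ∈ T, ∑ p ∈ T.erase q, F p q := by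
  refine Finset.sum_comm' fun p q => ?_
  simp only [Finset.mem_erase]
  constructor
  · rintro ⟨hp, hne, hq⟩; exact ⟨⟨Ne.symm hne, hp⟩, hq⟩
  · rintro ⟨⟨hne, hp⟩, hq⟩; exact ⟨hp, Ne.symm hne, hq⟩

/-- **Symmetrising an antisymmetric flux**: for `Φ q p = −Φ p q` on `T`,
`Σ_p Σ_{q≠p} ⟪Φ p q, W p⟫ = ½ Σ_p Σ_{q≠p} ⟪Φ p q, W p − W q⟫`. [folklore] -/
theorem flux_symmetrize {γ : Type*} [DecidableEq γ] (T : Finset γ) (Φ : γ → γ → EuclideanSpace ℝ (Fin 3))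
    (W : γ → EuclideanSpace ℝ (Fin 3)) (hanti : ∀ p ∈ T, ∀ q ∈ T, Φ q p = -Φ p q) :
    ∑ p ∈ T, ∑ q ∈ T.erase p, ⟪Φ p q, W p⟫ = (1 / 2) * ∑ p ∈ T, ∑ q ∈ T.erase p, ⟪Φ p q, W p - W q⟫ := by
  have hswap : ∑ p ∈ T, ∑ q ∈ T.erase p, ⟪Φ p q, W q⟫ = -∑ p ∈ T, ∑ q ∈ T.erase p, ⟪Φ p q, W p⟫ := by
    rw [sum_sum_erase_comm T (fun p q => ⟪Φ p q, W q⟫)]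
    rw [← Finset.sum_neg_distrib]
    refine Finset.sum_congr rfl fun q hq => ?_
    rw [← Finset.sum_neg_distrib]
    refine Finset.sum_congr rfl fun p hp => ?_
    rw [hanti q hq p (Finset.mem_erase.1 hp).2, inner_neg_left]
  have hsplit : ∑ p ∈ T, ∑ q ∈ T.erase p, ⟪Φ p q, W p - W q⟫ =
      ∑ p ∈ T, ∑ q ∈ T.erase p, ⟪Φ p q, W p⟫ - ∑ p ∈ T, ∑ q ∈ T.erase p, ⟪Φ p q, W q⟫ := by
    rw [← Finset.sum_sub_distrib]
    refine Finset.sum_congr rfl fun p _ => ?_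
    rw [← Finset.sum_sub_distrib]
    refine Finset.sum_congr rfl fun q _ => ?_
    rw [inner_sub_right]
  rw [hsplit, hswap]
  ring

section

variable {t : Fin 2 → (EuclideanSpace ℝ (Fin 3))} {A : (EuclideanSpace ℝ (Fin 3)) →L[ℝ] (EuclideanSpace ℝ (Fin 3))}
  {κ : ℝ}

set_option quotPrecheck false in
-- Local notation: the operator row `(L v)(p)`.
local notation "𝕃" v:max " @ " p:max =>
  tsum (fun q : Sites₀ t A => (if ((p : Sites₀ t A) : EuclideanSpace ℝ (Fin 3)) ≠ q then
    𝕂[((p : Sites₀ t A) : EuclideanSpace ℝ (Fin 3)) - q] (v ((p : Sites₀ t A) : EuclideanSpace ℝ (Fin 3)) - v q) else 0))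

/-! ## The comparison inequality -/

/-- **The comparison (energy) inequality in flux form**: if the finitely supported `w` has rows
`(L w)(p) = f p + Σ_{q ∈ SR, q ≠ p} Φ p q` at the sites `p ∈ FW` carrying its support, `FW ⊆ SR` (sites), and
`Φ` is antisymmetric on `SR`, then
`κ · nnForm w ≤ Σ_{p∈FW} ⟪f p, w p⟫ + ½ Σ_{p∈SR} Σ_{q∈SR, q≠p} ⟪Φ p q, w p − w q⟫`. [folklore] -/
theorem comparison_energy
    (hκ : ∀ v : (EuclideanSpace ℝ (Fin 3)) → (EuclideanSpace ℝ (Fin 3)), (Function.support v).Finite →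
      Function.support v ⊆ Sites₀ t A → κ * nnForm t A v ≤ ∑' p : Sites₀ t A, ⟪𝕃 v @ p, v p⟫)
    {w : (EuclideanSpace ℝ (Fin 3)) → (EuclideanSpace ℝ (Fin 3))} (hw : (Function.support w).Finite)
    (FW SR : Finset (EuclideanSpace ℝ (Fin 3))) (hFW : ∀ x, w x ≠ 0 → x ∈ FW) (hFWSR : FW ⊆ SR)
    (hSRS : ∀ x ∈ SR, x ∈ Sites₀ t A) (f : (EuclideanSpace ℝ (Fin 3)) → (EuclideanSpace ℝ (Fin 3)))
    (Φ : (EuclideanSpace ℝ (Fin 3)) → (EuclideanSpace ℝ (Fin 3)) → (EuclideanSpace ℝ (Fin 3)))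
    (hrow : ∀ p : Sites₀ t A, (p : EuclideanSpace ℝ (Fin 3)) ∈ FW →
      𝕃 w @ p = f p + ∑ q ∈ SR.erase p, Φ p q)
    (hanti : ∀ p ∈ SR, ∀ q ∈ SR, Φ q p = -Φ p q) :
    κ * nnForm t A w ≤ ∑ p ∈ FW, ⟪f p, w p⟫ + (1 / 2) * ∑ p ∈ SR, ∑ q ∈ SR.erase p, ⟪Φ p q, w p - w q⟫ := by
  classical
  have hwS : Function.support w ⊆ Sites₀ t A := fun x hx => hSRS x (hFWSR (hFW x hx))
  have hκw := hκ w hw hwS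
  -- the work as a finite sum over `FW`
  set T : Finset (Sites₀ t A) := FW.subtype (· ∈ Sites₀ t A) with hT
  have hmemT : ∀ p : Sites₀ t A, p ∉ T → w p = 0 := by
    intro p hp
    by_contra h
    exact hp (by rw [hT, Finset.mem_subtype]; exact hFW _ h)
  have hwork : (∑' p : Sites₀ t A, ⟪𝕃 w @ p, w p⟫) = ∑ p ∈ T, ⟪𝕃 w @ p, w p⟫ :=
    tsum_eq_sum fun p hp => by rw [hmemT p hp, inner_zero_right]
  have hFWmem : ∀ x ∈ FW, x ∈ Sites₀ t A := fun x hx => hSRS x (hFWSR hx)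
  have hwork' : ∑ p ∈ T, ⟪𝕃 w @ p, w p⟫ = ∑ x ∈ FW, (⟪f x, w x⟫ + ∑ q ∈ SR.erase x, ⟪Φ x q, w x⟫) := by
    have h1 : ∑ p ∈ T, ⟪𝕃 w @ p, w p⟫ = ∑ p ∈ T, (⟪f p, w p⟫ + ∑ q ∈ SR.erase p, ⟪Φ p q, w p⟫) := by
      refine Finset.sum_congr rfl fun p hp => ?_
      have hpF : (p : EuclideanSpace ℝ (Fin 3)) ∈ FW := by rw [hT, Finset.mem_subtype] at hp; exact hp
      rw [hrow p hpF, inner_add_left, sum_inner]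
    rw [h1]
    exact Finset.sum_subtype_of_mem (f := fun x => ⟪f x, w x⟫ + ∑ q ∈ SR.erase x, ⟪Φ x q, w x⟫) hFWmem
  rw [hwork, hwork', Finset.sum_add_distrib] at hκw
  -- extend the flux work from `FW` to `SR` (the added terms vanish) and symmetrise
  have hext : ∑ x ∈ FW, ∑ q ∈ SR.erase x, ⟪Φ x q, w x⟫ = ∑ x ∈ SR, ∑ q ∈ SR.erase x, ⟪Φ x q, w x⟫ := by
    refine Finset.sum_subset hFWSR fun x _ hx => ?_
    have : w x = 0 := by by_contra h; exact hx (hFW x h)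
    simp only [this, inner_zero_right, Finset.sum_const_zero]
  rw [hext, flux_symmetrize SR Φ w hanti] at hκw
  exact hκw

/-- **Absolute form**: `κ · nnForm w ≤ Σ_{p∈FW} ‖f p‖ ‖w p‖ + ½ Σ_{p∈SR} Σ_{q≠p} ‖Φ p q‖ ‖w p − w q‖`. [folklore] -/
theorem comparison_energy_abs
    (hκ : ∀ v : (EuclideanSpace ℝ (Fin 3)) → (EuclideanSpace ℝ (Fin 3)), (Function.support v).Finite →
      Function.support v ⊆ Sites₀ t A → κ * nnForm t A v ≤ ∑' p : Sites₀ t A, ⟪𝕃 v @ p, v p⟫)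
    {w : (EuclideanSpace ℝ (Fin 3)) → (EuclideanSpace ℝ (Fin 3))} (hw : (Function.support w).Finite)
    (FW SR : Finset (EuclideanSpace ℝ (Fin 3))) (hFW : ∀ x, w x ≠ 0 → x ∈ FW) (hFWSR : FW ⊆ SR)
    (hSRS : ∀ x ∈ SR, x ∈ Sites₀ t A) (f : (EuclideanSpace ℝ (Fin 3)) → (EuclideanSpace ℝ (Fin 3)))
    (Φ : (EuclideanSpace ℝ (Fin 3)) → (EuclideanSpace ℝ (Fin 3)) → (EuclideanSpace ℝ (Fin 3)))
    (hrow : ∀ p : Sites₀ t A, (p : EuclideanSpace ℝ (Fin 3)) ∈ FW →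
      𝕃 w @ p = f p + ∑ q ∈ SR.erase p, Φ p q)
    (hanti : ∀ p ∈ SR, ∀ q ∈ SR, Φ q p = -Φ p q) :
    κ * nnForm t A w ≤ ∑ p ∈ FW, ‖f p‖ * ‖w p‖ +
      (1 / 2) * ∑ p ∈ SR, ∑ q ∈ SR.erase p, ‖Φ p q‖ * ‖w p - w q‖ := by
  have h := comparison_energy hκ hw FW SR hFW hFWSR hSRS f Φ hrow hanti
  have h1 : ∑ p ∈ FW, ⟪f p, w p⟫ ≤ ∑ p ∈ FW, ‖f p‖ * ‖w p‖ :=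
    Finset.sum_le_sum fun p _ => real_inner_le_norm _ _
  have h2 : ∑ p ∈ SR, ∑ q ∈ SR.erase p, ⟪Φ p q, w p - w q⟫ ≤ ∑ p ∈ SR, ∑ q ∈ SR.erase p, ‖Φ p q‖ * ‖w p - w q‖ :=
    Finset.sum_le_sum fun p _ => Finset.sum_le_sum fun q _ => real_inner_le_norm _ _
  linarith

end

/-! ## The scalar solving step -/

/-- If `κ X² ≤ a X + b X` with `κ > 0`, `X ≥ 0`, `a, b ≥ 0` then `X ≤ (a + b)/κ` and `X² ≤ 2(a² + b²)/κ²`. [folklore] -/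
theorem sqrt_energy_le {κ X a b : ℝ} (hκ : 0 < κ) (hX : 0 ≤ X) (ha : 0 ≤ a) (hb : 0 ≤ b)
    (h : κ * X ^ 2 ≤ a * X + b * X) : X ≤ (a + b) / κ ∧ X ^ 2 ≤ 2 * (a ^ 2 + b ^ 2) / κ ^ 2 := by
  have h1 : X ≤ (a + b) / κ := by
    rw [le_div_iff₀ hκ]
    rcases hX.lt_or_eq with hX0 | hX0
    · have : X * κ * X ≤ (a + b) * X := by nlinarith
      exact le_of_mul_le_mul_right this hX0
    · rw [← hX0]; simp only [zero_mul]; positivity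
  refine ⟨h1, ?_⟩
  have h2 : X ^ 2 ≤ ((a + b) / κ) ^ 2 := pow_le_pow_left₀ hX h1 2
  have h3 : ((a + b) / κ) ^ 2 ≤ 2 * (a ^ 2 + b ^ 2) / κ ^ 2 := by
    rw [div_pow, div_le_div_iff_of_pos_right (by positivity)]
    nlinarith [sq_nonneg (a - b)]
  exact h2.trans h3

end Summit.AtomisticToContinuum.Crystallization.Theorems.ExcessDecayLiouville

end
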